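import Summits.QuantumFields.YangMills.Theorems.PoincareLipschitzMedianCentringLinearStepAt
import Summits.QuantumFields.YangMills.Theorems.PoincareLipschitzHistoryTailOfLinearTailDeep
import Summits.QuantumFields.YangMills.Theorems.PoincareLipschitzMedianCentringLinearTail
import Summits.QuantumFields.YangMills.Theorems.PoincareLipschitzBlockLipschitzL
import HarnessLib

/-!
# Crux `HistoryTailL` (stmt-QuantumFields-19936) — FILE K-18: the K2-LANE FACE v15 «ONLY THE CONSTRAINED HEIGHTS, ONLY BOXES POLYNOMIALLY
# BELOW β_K» (`HistoryTailL` ⟸ for every m: K1-exp on sides `n ≤ 17·L^(K−⌊(K−1)∕m⌋)` ∧ (Q) at heights `j ≤ K − ⌊(K−1)∕m⌋`; LEAD seat ym-ust-19936-w1 g11)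

Cell `ym3-torus` (YM ladder rung R3 = continuum SU(2) Yang–Mills on T³ — a RUNG, NOT the Clay problem: not d = 4, not infinite volume, not a
mass gap).  Helper `--supports stmt-QuantumFields-19936`; THEOREMS ONLY, def-free.

WHAT THIS FILE SHOWS (a second scope statement for the two measure-side rows of the K2 lane, by kernel).  `UnitScaleTilt.HistoryTailL` asks
`HistoryTailAt F γ b₀ p₀ m` for EVERY free top fraction `1∕m`, with the profile `(b₀, p₀)` fixed before `m` and the coupling threshold `γ₁` after.
`HistoryTailAt … m` only constrains the averaged heights `j ≤ K' − ⌊K∕m⌋` of the runs `K' ∈ {K, K+1}` — the top `⌊K∕m⌋` heights are FREE.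
Threading this through the K2 lane (K-18b ✓`historyTailL_of_linearTail_deep`, K-18a ✓`local_step_lin_median_at`) gives the face v15:
for each `m` separately (constants `Cc, cc, γ₁` may depend on `m`),
* the K1 row is read only on box sides `n = 17·L^j` with `j + 2 ≤ K` AND `j + ⌊(K−1)∕m⌋ ≤ K`, i.e. `n ≤ 17·L^(K−⌊(K−1)∕m⌋)` — boxes whose
  side is POLYNOMIALLY below `β_K = L^K∕γ` (`n ≲ 17L·(γβ_K)^{1−1∕m}`), physical side `17·L^{−⌊(K−1)∕m⌋}` → 0 as the cut-off is removed;
* the quantile row (Q) is read only at the heights `j + ⌊(K−1)∕m⌋ ≤ K` (block sides `L^j` polynomially below `β_K` likewise).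
The price of m-dependent constants with an m-independent profile is paid by `p₀ > 2`: `p_{b₀,p₀}(g) ≥ p_{8∕c,p₀−1}(g)` once
`log γ⁻¹ ≥ 16∕(c·b₀)` (K-18b `pFun_substitute_le`), so every landed p-linear estimate runs at the substitute profile.
* `local_tail_lin_median_deep` — T-6's strong induction with the guards and the substitute-profile budget;
* ★★★ `historyTailL_of_deepUVBoxExpConcentration_quantile (hC : ⟨K1-exp-deepUV⟩) (hLip : BlockLipschitzL) (hQ : ⟨(Q)-deep⟩) : UnitScaleTilt.HistoryTailL`;
* ★★★ `historyTailL_of_K1deepUV_quantile (hK1m) (hQm)` — the face, `hLip :=` the PROVED K2 crux ✓`PoincareLipschitzBlockLipschitzL.blockLipschitzL_proof`.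

CENSUS v14 ✓p741117 → v15: removed [] · added [] · changed [hK1uv ↦ hK1m: per m, the SAME letter with the extra guard `n·L^⌊(K−1)∕m⌋ ≤ 17·L^K`
(constants after m); hQ ↦ hQm: per m, (Q) only at heights `j + ⌊(K−1)∕m⌋ ≤ K`].  Both rows strictly weaker: v14 (hence v12′) follows from v15 by
instantiating the m-families with m-independent data and dropping the guards.  For the planner: neither measure-side row of 19936 is ever read at
the top `⌊K∕m⌋` heights ∕ on boxes within a factor `(γβ_K)^{1∕m}` of the crossover scale.  NOTHING of K1-exp-deepUV, (Q)-deep is proved here;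
`HistoryTailL` is NOT proved; YM₃ on T³ is rung R3, not Clay; the Yang–Mills mass gap is NOT proved.

[adapted verbatim from ✓`PoincareLipschitzMedianCentringLinearTail.{local_tail_lin_median, historyTailL_of_expConcentration_quantile}` (ym3-torus-px10 g6),
themselves from ✓`PoincareLipschitzLinearTail` (ym-ust-19936-w4 g12); credits there.]
References: T. Bałaban, CMP 102 (1985) 255–275 [Balaban1985UV3]; T. Bałaban, CMP 98 (1985) 17–51 [Balaban1985Averaging]; M. Ledoux, The
concentration of measure phenomenon, AMS (2001) [Ledoux2001].
-/

set_option autoImplicit false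

noncomputable section

namespace Summit.QuantumFields.YangMills.Theorems.PoincareLipschitzHistoryTailOfDeepUVBoxConcentration

open MeasureTheory
open scoped BigOperators
open Literature.MathematicalPhysics.QuantumFieldTheory.Balaban1983to89
open Literature.MathematicalPhysics.QuantumFieldTheory.Balaban1983to89.T3ContinuumYM3Torus
open Literature.MathematicalPhysics.QuantumFieldTheory.Balaban1983to89.T3UnitScaleTilt
open Literature.MathematicalPhysics.QuantumFieldTheory.Balaban1983to89.T3UnitLawDensityEML (ℰp measurableE_ℰp)
open Summit.QuantumFields.YangMills.Theorems.PoincareLipschitz.TwoSidedOfConcentration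
open Summit.QuantumFields.YangMills.Theorems.HistoryTailBoundedHeightLocal (perPlaquette_boundedHeight_uniform)
open Summit.QuantumFields.YangMills.Theorems.PoincareLipschitzLinear (localGood_budget_lin)
open Summit.QuantumFields.YangMills.Theorems.PoincareLipschitz.MedianCentring (le_pFun_of_coupling_small)
open Summit.QuantumFields.YangMills.Theorems.PoincareLipschitzMedianCentringLinearStepAt (local_step_lin_median_at)
open Summit.QuantumFields.YangMills.Theorems.PoincareLipschitzHistoryTailOfLinearTailDeep
  (historyTailL_of_linearTail_deep exp_neg_pFun_substitute_le exp_neg_pFun_sq_substitute_le)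
open Summit.QuantumFields.YangMills.Theorems.PoincareLipschitzBlockLipschitzL (blockLipschitzL_proof)

/-! ## §1 The height induction at the constrained heights and the knit -/

/-- **THE p-LINEAR LOCAL WINDOW TAIL AT THE CONSTRAINED HEIGHTS, CONSTANTS AFTER `m`.**  As ✓`PoincareLipschitz.MedianCentring.local_tail_lin_median`
(strong induction on the height with the median-centred step), with: the concentration hypothesis asked per `m` only on the sides
`n ≤ 17·L^(K−2)`, `n·L^⌊(K−1)∕m⌋ ≤ 17·L^K`; the quantile row only at heights `j + ⌊(K−1)∕m⌋ ≤ K`; the conclusion only at those heights; and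
NO threshold `bmin ≤ b₀` — the budget ✓`localGood_budget_lin` and the per-height weakening run at the SUBSTITUTE profile `(8∕c₁, p₀ − 1)`
(✓`pFun_substitute_le`, valid once `γ ≤ e^{−2(8∕c₁)∕b₀}`), the events keeping the true profile.  Step: ✓`local_step_lin_median_at`.
[cite: Balaban1985UV3, (7) p.257 and (71) p.273; Ledoux2001, Prop. 1.3] -/
theorem local_tail_lin_median_deep
    (hC : ∀ (L m : ℕ), 0 < m → ∃ (Cc cc : ℝ), 0 ≤ Cc ∧ 0 < cc ∧ ∃ γ₁ : ℝ, 0 < γ₁ ∧ γ₁ ≤ 1 ∧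
      ∀ (F : T3Family) (γ : ℝ), F.L = L → 0 < γ → γ ≤ γ₁ → ∀ (K n : ℕ), 1 ≤ n → n ≤ 17 * F.L ^ (K - 2) →
        n * F.L ^ ((K - 1) / m) ≤ 17 * F.L ^ K → (n : ℝ) ≤ (F.scheme ℰp γ).β K → 2 * n ≤ (F.P K).sitesPerDir 0 →
        ∀ (x₀ : Site (F.P K) 0) (f : GaugeField (F.P K) 0 (Matrix.specialUnitaryGroup (Fin 2) ℂ) → ℝ) (Λ : ℝ), 0 < Λ →
          Measurable f → GaugeField.GaugeInvariant f →
          (∀ U U' : GaugeField (F.P K) 0 (Matrix.specialUnitaryGroup (Fin 2) ℂ),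
            (∀ b : PBond (F.P K) 0, (∀ k, (b.src k - x₀ k).val < n) → (∀ k, (b.tgt k - x₀ k).val < n) → U b = U' b) →
              f U = f U') →
          (∀ U U' : GaugeField (F.P K) 0 (Matrix.specialUnitaryGroup (Fin 2) ℂ),
            |f U - f U'| ≤ Λ * Real.sqrt (∑ b : PBond (F.P K) 0, GaugeGroup.dist1 (U b * (U' b)⁻¹) ^ 2)) →
          ∀ r : ℝ, 0 ≤ r →
            (gibbsK F ℰp γ K).real {U | r ≤ f U - ∫ V, f V ∂(gibbsK F ℰp γ K)} ≤
              Cc * Real.exp (-(cc * Real.sqrt ((F.scheme ℰp γ).β K) * r / ((n : ℝ) * Λ))))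
    (hLip : Summit.QuantumFields.YangMills.Theses.PoincareLipschitz.BlockLipschitzL)
    (hQ : ∀ (L m : ℕ) (b₀ p₀ : ℝ), 0 < m → 0 < b₀ → 2 < p₀ → ∃ γ₁ : ℝ, 0 < γ₁ ∧ γ₁ ≤ 1 ∧ ∀ (F : T3Family) (γ : ℝ), F.L = L → 0 < γ → γ ≤ γ₁ →
            ∀ (K j : ℕ), 1 ≤ j → j + 2 ≤ K → j + (K - 1) / m ≤ K → ∀ a : Plaq (F.P K) j,
              3 / 4 ≤ (gibbsK F ℰp γ K).real {U : GaugeField (F.P K) 0 (Matrix.specialUnitaryGroup (Fin 2) ℂ) | GaugeGroup.dist1 (GaugeField.plaqHol (Averaging.iter (fun i' => BlockAveraging.blockAvg (P := F.P K) (j := i') ℰp) j U) a) ≤ θBal F.L γ b₀ p₀ (K - j) / 8})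
    (L m : ℕ) (hm : 0 < m) :
    ∃ (C c : ℝ), 0 ≤ C ∧ 0 < c ∧ ∀ (b₀ p₀ : ℝ), 0 < b₀ → 2 < p₀ →
      ∃ γ₁ : ℝ, 0 < γ₁ ∧ γ₁ ≤ 1 ∧ ∀ (F : T3Family) (γ : ℝ), F.L = L → 0 < γ → γ ≤ γ₁ →
      ∀ (K j : ℕ), 1 ≤ j → j + 2 ≤ K → j + (K - 1) / m ≤ K → ∀ a : Plaq (F.P K) j,
        (gibbsK F ℰp γ K).real ({U : GaugeField (F.P K) 0 (Matrix.specialUnitaryGroup (Fin 2) ℂ) | θBal F.L γ b₀ p₀ (K - j) ≤ GaugeGroup.dist1 (GaugeField.plaqHol (Averaging.iter (fun i' => BlockAveraging.blockAvg (P := F.P K) (j := i') ℰp) j U) a)} ∩ {U : GaugeField (F.P K) 0 (Matrix.specialUnitaryGroup (Fin 2) ℂ) | (∀ (i : ℕ) (q : Plaq (F.P K) i), i < j → Site.tdist (fun k => ((((q.src k).val * F.L ^ i : ℕ)) : ZMod ((F.P K).sitesPerDir 0))) (fun k => ((((a.src k).val * F.L ^ j : ℕ)) : ZMod ((F.P K).sitesPerDir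 0))) + 64 * F.L ^ i ≤ 64 * F.L ^ j → GaugeGroup.dist1 (GaugeField.plaqHol (Averaging.iter (fun i' => BlockAveraging.blockAvg (P := F.P K) (j := i') ℰp) i U) q) < θBal F.L γ b₀ p₀ (K - i))}) ≤
          C * Real.exp (-(c * B10.pFun b₀ p₀ (Real.sqrt (γ * ((F.L : ℝ)⁻¹) ^ (K - j))))) := by
  -- the constants of the three hypotheses and of the level-0 input
  obtain ⟨Cc, cc, hCc, hcc, γC, hγC, hγC1, HC⟩ := hC L m hm
  obtain ⟨CL, hCL, HLip⟩ := hLip L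
  obtain ⟨C₀, c₀, hC₀, hc₀, H0⟩ := perPlaquette_boundedHeight_uniform L 0
  -- degenerate block size: no family has `F.L = L < 2`
  by_cases hL : 2 ≤ L
  swap
  · refine ⟨0, 1, le_rfl, one_pos, fun b₀ p₀ _ _ => ⟨1, one_pos, le_rfl, fun F γ hFL => ?_⟩⟩
    exact absurd (hFL ▸ F.hL.2) (by omega)
  -- the p-linear rate; NO profile threshold: the SUBSTITUTE amplitude `b' = 8/c₁` (so `c₁ b' = 8`) at exponent `p₀ − 1 ≥ 1`
  set c₁ : ℝ := cc / (68 * (CL + 1)) with hc₁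
  have hc₁pos : 0 < c₁ := by positivity
  refine ⟨Cc, c₁, hCc, hc₁pos, fun b₀ p₀ hb₀ hp₀ => ?_⟩
  set b' : ℝ := 8 / c₁ with hb'
  have hb'0 : 0 < b' := by positivity
  have hcb : 8 ≤ c₁ * b' := by rw [hb', mul_div_cancel₀ _ hc₁pos.ne']
  have hp' : (1 : ℝ) ≤ p₀ - 1 := by linarith
  set γs : ℝ := Real.exp (-(2 * (b' / b₀))) with hγs
  have hγs0 : 0 < γs := Real.exp_pos _
  obtain ⟨γLip, hγLip, hγLip1, HLip'⟩ := HLip b₀ p₀ hb₀ hp₀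
  obtain ⟨γQ, hγQ, hγQ1, HQ⟩ := hQ L m b₀ p₀ hm hb₀ hp₀
  -- the extra `γ`-smallness row of the median step (p-linear): `136(CL+1)·log(2Cc+2)/cc ≤ p(g_(K−j))` once `γ ≤ γp`
  set M : ℝ := 136 * (CL + 1) * (Real.log (2 * Cc + 2) / cc) with hM
  set M' : ℝ := max M 0 with hM'
  have hM'0 : 0 ≤ M' := le_max_right _ _
  have hMM' : M ≤ M' := le_max_left _ _
  set γp : ℝ := Real.exp (-(2 * (M' / b₀))) with hγp
  have hγp0 : 0 < γp := Real.exp_pos _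
  obtain ⟨γA, hγA, hγA1, HA⟩ := localGood_budget_lin hL hb'0 hp'
    (by norm_num : (0 : ℝ) ≤ 9 * 129 ^ 3) hC₀ hc₀ hCc hc₁pos hcb
  refine ⟨min γC (min γLip (min γQ (min γA (min γp (min γs (1 / 2)))))), by positivity, (min_le_left _ _).trans hγC1,
    fun F γ hFL hγ hγle K => ?_⟩
  have hγC' : γ ≤ γC := hγle.trans (min_le_left _ _)
  have hγLip' : γ ≤ γLip := hγle.trans ((min_le_right _ _).trans (min_le_left _ _))
  have hγQ' : γ ≤ γQ := hγle.trans ((min_le_right _ _).trans ((min_le_right _ _).trans (min_le_left _ _)))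
  have hγA' : γ ≤ γA :=
    hγle.trans ((min_le_right _ _).trans ((min_le_right _ _).trans ((min_le_right _ _).trans (min_le_left _ _))))
  have hγp' : γ ≤ γp :=
    hγle.trans ((min_le_right _ _).trans ((min_le_right _ _).trans ((min_le_right _ _).trans ((min_le_right _ _).trans (min_le_left _ _)))))
  have hγs' : γ ≤ γs :=
    hγle.trans ((min_le_right _ _).trans ((min_le_right _ _).trans ((min_le_right _ _).trans ((min_le_right _ _).trans ((min_le_right _ _).trans (min_le_left _ _))))))
  have hγ2 : γ ≤ 1 / 2 :=
    hγle.trans ((min_le_right _ _).trans ((min_le_right _ _).trans ((min_le_right _ _).trans ((min_le_right _ _).trans ((min_le_right _ _).trans (min_le_right _ _))))))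
  have hγ1 : γ ≤ 1 := by linarith
  subst hFL
  have hL1 : 1 ≤ F.L := F.hL.2.le
  haveI := isProbabilityMeasure_gibbsK F ℰp hγ.le K
  have hβ : (F.scheme ℰp γ).β K = (γ * ((F.L : ℝ)⁻¹) ^ K)⁻¹ := rfl
  -- strong induction on the level `j`
  intro j
  induction j using Nat.strong_induction_on with
  | _ j ih =>
  intro hj hjK hjm a
  -- the complement of the local good set is rare
  have hGc : (gibbsK F ℰp γ K).real {U : GaugeField (F.P K) 0 (Matrix.specialUnitaryGroup (Fin 2) ℂ) | (∀ (i : ℕ) (q : Plaq (F.P K) i), i < j → Site.tdist (fun k => ((((q.src k).val * F.L ^ i : ℕ)) : ZMod ((F.P K).sitesPerDir 0))) (fun k => ((((a.src k).val * F.L ^ j : ℕ)) : ZMod ((F.P K).sitesPerDir 0))) + 64 * F.L ^ i ≤ 64 * F.L ^ j → GaugeGroup.dist1 (GaugeField.plaqHol (Averaging.iter (fun i' => BlockAveraging.blockAvg (P := F.P K) (j := i') ℰp) i U) q) < θBal F.L γ b₀ p₀ (K - i))}ᶜ ≤ 1 / 4 := by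
    have hcov := compl_localGood_subset F (X := GaugeField (F.P K) 0 (Matrix.specialUnitaryGroup (Fin 2) ℂ)) K j a
      (fun i q U => GaugeGroup.dist1 (GaugeField.plaqHol (Averaging.iter (fun i' => BlockAveraging.blockAvg (P := F.P K) (j := i') ℰp) i U) q)) (fun i => θBal F.L γ b₀ p₀ (K - i))
    beta_reduce at hcov
    -- level 0: the tree's volume-uniform finest-level tail
    have h0 : ∀ q : Plaq (F.P K) 0, (gibbsK F ℰp γ K).real ({U : GaugeField (F.P K) 0 (Matrix.specialUnitaryGroup (Fin 2) ℂ) | θBal F.L γ b₀ p₀ (K - 0) ≤ GaugeGroup.dist1 (GaugeField.plaqHol (Averaging.iter (fun i' => BlockAveraging.blockAvg (P := F.P K) (j := i') ℰp) 0 U) q)} ∩ {U : GaugeField (F.P K) 0 (Matrix.specialUnitaryGroup (Fin 2) ℂ) | (∀ (i' : ℕ) (q' : Plaq (F.P K) i'), i' < 0 → Site.tdist (fun k => ((((q'.src k).val * F.L ^ i' : ℕ)) : ZMod ((F.P K).sitesPerDir 0))) (fun k => ((((q.src k).val * F.L ^ 0 : ℕ)) : ZMod ((F.P K).sitesPerDir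 0))) + 64 * F.L ^ i' ≤ 64 * F.L ^ 0 → GaugeGroup.dist1 (GaugeField.plaqHol (Averaging.iter (fun i' => BlockAveraging.blockAvg (P := F.P K) (j := i') ℰp) i' U) q') < θBal F.L γ b₀ p₀ (K - i'))}) ≤
        C₀ * ((γ * ((F.L : ℝ)⁻¹) ^ K)⁻¹) ^ 5 * Real.exp (-(c₀ * B10.pFun b' (p₀ - 1) (Real.sqrt (γ * ((F.L : ℝ)⁻¹) ^ (K))) ^ 2)) := by
      intro q
      have h := H0 F rfl γ hγ hγ1 b₀ hb₀.le p₀ K 0 (Nat.zero_le K) le_rfl q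
      simp only [Nat.sub_zero] at h
      rw [hβ] at h
      exact ((measureReal_mono Set.inter_subset_left (measure_ne_top _ _)).trans h).trans
        (mul_le_mul_of_nonneg_left (exp_neg_pFun_sq_substitute_le hL1 p₀ hγ hγ1 hb₀ hb'0.le hc₀ hγs' K) (by positivity))
    -- levels `1 ≤ i < j`: the induction hypothesis
    have hi : ∀ i ∈ Finset.Ico 1 j, ∀ q : Plaq (F.P K) i, (gibbsK F ℰp γ K).real ({U : GaugeField (F.P K) 0 (Matrix.specialUnitaryGroup (Fin 2) ℂ) | θBal F.L γ b₀ p₀ (K - i) ≤ GaugeGroup.dist1 (GaugeField.plaqHol (Averaging.iter (fun i' => BlockAveraging.blockAvg (P := F.P K) (j := i') ℰp) i U) q)} ∩ {U : GaugeField (F.P K) 0 (Matrix.specialUnitaryGroup (Fin 2) ℂ) | (∀ (i' : ℕ) (q' : Plaq (F.P K) i'), i' < i → Site.tdist (fun k => ((((q'.src k).val * F.L ^ i' : ℕ)) : ZMod ((F.P K).sitesPerDir 0))) (fun k => ((((q.src k).val * F.L ^ i : ℕ)) : ZMod ((F.P K).sitesPerDir 0))) + 64 * F.L ^ i' ≤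 64 * F.L ^ i → GaugeGroup.dist1 (GaugeField.plaqHol (Averaging.iter (fun i' => BlockAveraging.blockAvg (P := F.P K) (j := i') ℰp) i' U) q') < θBal F.L γ b₀ p₀ (K - i'))}) ≤
        Cc * Real.exp (-(c₁ * B10.pFun b' (p₀ - 1) (Real.sqrt (γ * ((F.L : ℝ)⁻¹) ^ (K - i))))) := by
      intro i hi q
      rw [Finset.mem_Ico] at hi
      exact (ih i hi.2 hi.1 (by omega) (by omega) q).trans
        (mul_le_mul_of_nonneg_left (exp_neg_pFun_substitute_le hL1 p₀ hγ hγ1 hb₀ hc₁pos hγs' (K - i)) hCc)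
    -- the counts
    have hN : ∀ i, i ≤ j → (((Finset.univ.filter fun q : Plaq (F.P K) i => Site.tdist (fun k => ((((q.src k).val * F.L ^ i : ℕ)) : ZMod ((F.P K).sitesPerDir 0))) (fun k => ((((a.src k).val * F.L ^ j : ℕ)) : ZMod ((F.P K).sitesPerDir 0))) + 64 * F.L ^ i ≤ 64 * F.L ^ j)).card : ℝ) ≤ 9 * 129 ^ 3 * ((F.L : ℝ) ^ (j - i)) ^ 3 :=
      fun i hij => card_near_le_real F hij (by omega) a
    calc (gibbsK F ℰp γ K).real {U : GaugeField (F.P K) 0 (Matrix.specialUnitaryGroup (Fin 2) ℂ) | (∀ (i : ℕ) (q : Plaq (F.P K) i), i < j → Site.tdist (fun k => ((((q.src k).val * F.L ^ i : ℕ)) : ZMod ((F.P K).sitesPerDir 0))) (fun k => ((((a.src k).val * F.L ^ j : ℕ)) : ZMod ((F.P K).sitesPerDir 0))) + 64 * F.L ^ i ≤ 64 * F.L ^ j → GaugeGroup.dist1 (GaugeField.plaqHol (Averaging.iter (fun i' => BlockAveraging.blockAvg (P := F.P K) (j := i') ℰp) i U) q) < θBal F.L γ b₀ p₀ (K - i)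)}ᶜ
        ≤ (gibbsK F ℰp γ K).real (⋃ i ∈ Finset.range j, ⋃ q ∈ (Finset.univ.filter fun q : Plaq (F.P K) i => Site.tdist (fun k => ((((q.src k).val * F.L ^ i : ℕ)) : ZMod ((F.P K).sitesPerDir 0))) (fun k => ((((a.src k).val * F.L ^ j : ℕ)) : ZMod ((F.P K).sitesPerDir 0))) + 64 * F.L ^ i ≤ 64 * F.L ^ j), ({U : GaugeField (F.P K) 0 (Matrix.specialUnitaryGroup (Fin 2) ℂ) | θBal F.L γ b₀ p₀ (K - i) ≤ GaugeGroup.dist1 (GaugeField.plaqHol (Averaging.iter (fun i' => BlockAveraging.blockAvg (P := F.P K) (j := i') ℰp) i U) q)} ∩ {U : GaugeField (F.P K) 0 (Matrix.specialUnitaryGroup (Fin 2) ℂ) | (∀ (i' : ℕ) (q' : Plaq (F.P K) i'), i' < i → Site.tdist (fun k => ((((q'.src k).val * F.L ^ i' : ℕ)) : ZMod ((F.P K).sitesPerDir 0))) (fun k => ((((q.src k).val * F.L ^ i : ℕ)) : ZMod ((F.P K).sitesPerDir 0))) + 64 * F.L ^ i' ≤ 64 * F.L ^ i → GaugeGroup.dist1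 (GaugeField.plaqHol (Averaging.iter (fun i' => BlockAveraging.blockAvg (P := F.P K) (j := i') ℰp) i' U) q') < θBal F.L γ b₀ p₀ (K - i'))})) :=
          measureReal_mono hcov (measure_ne_top _ _)
      _ ≤ ∑ i ∈ Finset.range j, (gibbsK F ℰp γ K).real (⋃ q ∈ (Finset.univ.filter fun q : Plaq (F.P K) i => Site.tdist (fun k => ((((q.src k).val * F.L ^ i : ℕ)) : ZMod ((F.P K).sitesPerDir 0))) (fun k => ((((a.src k).val * F.L ^ j : ℕ)) : ZMod ((F.P K).sitesPerDir 0))) + 64 * F.L ^ i ≤ 64 * F.L ^ j), ({U : GaugeField (F.P K) 0 (Matrix.specialUnitaryGroup (Fin 2) ℂ) | θBal F.L γ b₀ p₀ (K - i) ≤ GaugeGroup.dist1 (GaugeField.plaqHol (Averaging.iter (fun i' => BlockAveraging.blockAvg (P := F.P K) (j := i') ℰp) i U) q)} ∩ {U : GaugeField (F.P K) 0 (Matrix.specialUnitaryGroup (Fin 2) ℂ) | (∀ (i' : ℕ) (q' : Plaq (F.P K) i'), i' < i → Site.tdist (fun k => ((((q'.src k).val * F.L ^ i' : ℕ)) : ZMod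 ((F.P K).sitesPerDir 0))) (fun k => ((((q.src k).val * F.L ^ i : ℕ)) : ZMod ((F.P K).sitesPerDir 0))) + 64 * F.L ^ i' ≤ 64 * F.L ^ i → GaugeGroup.dist1 (GaugeField.plaqHol (Averaging.iter (fun i' => BlockAveraging.blockAvg (P := F.P K) (j := i') ℰp) i' U) q') < θBal F.L γ b₀ p₀ (K - i'))})) :=
          measureReal_biUnion_finset_le _ _
      _ ≤ ∑ i ∈ Finset.range j, ∑ q ∈ (Finset.univ.filter fun q : Plaq (F.P K) i => Site.tdist (fun k => ((((q.src k).val * F.L ^ i : ℕ)) : ZMod ((F.P K).sitesPerDir 0))) (fun k => ((((a.src k).val * F.L ^ j : ℕ)) : ZMod ((F.P K).sitesPerDir 0))) + 64 * F.L ^ i ≤ 64 * F.L ^ j), (gibbsK F ℰp γ K).real ({U : GaugeField (F.P K) 0 (Matrix.specialUnitaryGroup (Fin 2) ℂ) | θBal F.L γ b₀ p₀ (K - i) ≤ GaugeGroup.dist1 (GaugeField.plaqHol (Averaging.iter (fun i' => BlockAveraging.blockAvg (P := F.P K) (j := i') ℰp) i U) q)} ∩ {U : GaugeField (F.P K) 0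 (Matrix.specialUnitaryGroup (Fin 2) ℂ) | (∀ (i' : ℕ) (q' : Plaq (F.P K) i'), i' < i → Site.tdist (fun k => ((((q'.src k).val * F.L ^ i' : ℕ)) : ZMod ((F.P K).sitesPerDir 0))) (fun k => ((((q.src k).val * F.L ^ i : ℕ)) : ZMod ((F.P K).sitesPerDir 0))) + 64 * F.L ^ i' ≤ 64 * F.L ^ i → GaugeGroup.dist1 (GaugeField.plaqHol (Averaging.iter (fun i' => BlockAveraging.blockAvg (P := F.P K) (j := i') ℰp) i' U) q') < θBal F.L γ b₀ p₀ (K - i'))}) :=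
          Finset.sum_le_sum fun i _ => measureReal_biUnion_finset_le _ _
      _ = ∑ q ∈ (Finset.univ.filter fun q : Plaq (F.P K) 0 => Site.tdist (fun k => ((((q.src k).val * F.L ^ 0 : ℕ)) : ZMod ((F.P K).sitesPerDir 0))) (fun k => ((((a.src k).val * F.L ^ j : ℕ)) : ZMod ((F.P K).sitesPerDir 0))) + 64 * F.L ^ 0 ≤ 64 * F.L ^ j), (gibbsK F ℰp γ K).real ({U : GaugeField (F.P K) 0 (Matrix.specialUnitaryGroup (Fin 2) ℂ) | θBal F.L γ b₀ p₀ (K - 0) ≤ GaugeGroup.dist1 (GaugeField.plaqHol (Averaging.iter (fun i' => BlockAveraging.blockAvg (P := F.P K) (j := i') ℰp) 0 U) q)} ∩ {U : GaugeField (F.P K) 0 (Matrix.specialUnitaryGroup (Fin 2) ℂ) | (∀ (i' : ℕ) (q' : Plaq (F.P K) i'), i' < 0 → Site.tdist (fun k => ((((q'.src k).val * F.L ^ i' : ℕ)) : ZMod ((F.P K).sitesPerDir 0))) (fun k => ((((q.src k).val * F.L ^ 0 : ℕ)) : ZMod ((F.P K).sitesPerDir 0))) + 64 * F.L ^ i'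 ≤ 64 * F.L ^ 0 → GaugeGroup.dist1 (GaugeField.plaqHol (Averaging.iter (fun i' => BlockAveraging.blockAvg (P := F.P K) (j := i') ℰp) i' U) q') < θBal F.L γ b₀ p₀ (K - i'))}) +
            ∑ i ∈ Finset.Ico 1 j, ∑ q ∈ (Finset.univ.filter fun q : Plaq (F.P K) i => Site.tdist (fun k => ((((q.src k).val * F.L ^ i : ℕ)) : ZMod ((F.P K).sitesPerDir 0))) (fun k => ((((a.src k).val * F.L ^ j : ℕ)) : ZMod ((F.P K).sitesPerDir 0))) + 64 * F.L ^ i ≤ 64 * F.L ^ j), (gibbsK F ℰp γ K).real ({U : GaugeField (F.P K) 0 (Matrix.specialUnitaryGroup (Fin 2) ℂ) | θBal F.L γ b₀ p₀ (K - i) ≤ GaugeGroup.dist1 (GaugeField.plaqHol (Averaging.iter (fun i' => BlockAveraging.blockAvg (P := F.P K) (j := i') ℰp) i U) q)} ∩ {U : GaugeField (F.P K) 0 (Matrix.specialUnitaryGroup (Fin 2) ℂ) | (∀ (i' : ℕ) (q' : Plaq (F.P K) i'), i' < i → Site.tdist (fun k => ((((q'.src k).val * F.L ^ i' : ℕ))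 : ZMod ((F.P K).sitesPerDir 0))) (fun k => ((((q.src k).val * F.L ^ i : ℕ)) : ZMod ((F.P K).sitesPerDir 0))) + 64 * F.L ^ i' ≤ 64 * F.L ^ i → GaugeGroup.dist1 (GaugeField.plaqHol (Averaging.iter (fun i' => BlockAveraging.blockAvg (P := F.P K) (j := i') ℰp) i' U) q') < θBal F.L γ b₀ p₀ (K - i'))}) := by
          rw [Finset.range_eq_Ico, Finset.sum_eq_sum_Ico_succ_bot hj]
      _ ≤ 9 * 129 ^ 3 * ((F.L : ℝ) ^ j) ^ 3 * (C₀ * ((γ * ((F.L : ℝ)⁻¹) ^ K)⁻¹) ^ 5 * Real.exp (-(c₀ * B10.pFun b' (p₀ - 1) (Real.sqrt (γ * ((F.L : ℝ)⁻¹) ^ (K))) ^ 2))) +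
            ∑ i ∈ Finset.Ico 1 j, 9 * 129 ^ 3 * ((F.L : ℝ) ^ (j - i)) ^ 3 * (Cc * Real.exp (-(c₁ * B10.pFun b' (p₀ - 1) (Real.sqrt (γ * ((F.L : ℝ)⁻¹) ^ (K - i)))))) := by
          refine add_le_add ?_ (Finset.sum_le_sum fun i hi' => ?_)
          · calc ∑ q ∈ (Finset.univ.filter fun q : Plaq (F.P K) 0 => Site.tdist (fun k => ((((q.src k).val * F.L ^ 0 : ℕ)) : ZMod ((F.P K).sitesPerDir 0))) (fun k => ((((a.src k).val * F.L ^ j : ℕ)) : ZMod ((F.P K).sitesPerDir 0))) + 64 * F.L ^ 0 ≤ 64 * F.L ^ j), (gibbsK F ℰp γ K).real ({U : GaugeField (F.P K) 0 (Matrix.specialUnitaryGroup (Fin 2) ℂ) | θBal F.L γ b₀ p₀ (K - 0) ≤ GaugeGroup.dist1 (GaugeField.plaqHol (Averaging.iter (fun i' => BlockAveraging.blockAvg (P := F.P K) (j := i') ℰp) 0 U) q)} ∩ {U : GaugeField (F.P K) 0 (Matrix.specialUnitaryGroup (Fin 2) ℂ) | (∀ (i' : ℕ) (q' : Plaq (F.P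 K) i'), i' < 0 → Site.tdist (fun k => ((((q'.src k).val * F.L ^ i' : ℕ)) : ZMod ((F.P K).sitesPerDir 0))) (fun k => ((((q.src k).val * F.L ^ 0 : ℕ)) : ZMod ((F.P K).sitesPerDir 0))) + 64 * F.L ^ i' ≤ 64 * F.L ^ 0 → GaugeGroup.dist1 (GaugeField.plaqHol (Averaging.iter (fun i' => BlockAveraging.blockAvg (P := F.P K) (j := i') ℰp) i' U) q') < θBal F.L γ b₀ p₀ (K - i'))})
                ≤ ∑ q ∈ (Finset.univ.filter fun q : Plaq (F.P K) 0 => Site.tdist (fun k => ((((q.src k).val * F.L ^ 0 : ℕ)) : ZMod ((F.P K).sitesPerDir 0))) (fun k => ((((a.src k).val * F.L ^ j : ℕ)) : ZMod ((F.P K).sitesPerDir 0))) + 64 * F.L ^ 0 ≤ 64 * F.L ^ j), C₀ * ((γ * ((F.L : ℝ)⁻¹) ^ K)⁻¹) ^ 5 * Real.exp (-(c₀ * B10.pFun b' (p₀ - 1) (Real.sqrt (γ * ((F.L : ℝ)⁻¹) ^ (K))) ^ 2)) :=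
                  Finset.sum_le_sum fun q _ => h0 q
              _ = ((Finset.univ.filter fun q : Plaq (F.P K) 0 => Site.tdist (fun k => ((((q.src k).val * F.L ^ 0 : ℕ)) : ZMod ((F.P K).sitesPerDir 0))) (fun k => ((((a.src k).val * F.L ^ j : ℕ)) : ZMod ((F.P K).sitesPerDir 0))) + 64 * F.L ^ 0 ≤ 64 * F.L ^ j)).card * (C₀ * ((γ * ((F.L : ℝ)⁻¹) ^ K)⁻¹) ^ 5 * Real.exp (-(c₀ * B10.pFun b' (p₀ - 1) (Real.sqrt (γ * ((F.L : ℝ)⁻¹) ^ (K))) ^ 2))) := by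
                  rw [Finset.sum_const, nsmul_eq_mul]
              _ ≤ 9 * 129 ^ 3 * ((F.L : ℝ) ^ j) ^ 3 * (C₀ * ((γ * ((F.L : ℝ)⁻¹) ^ K)⁻¹) ^ 5 * Real.exp (-(c₀ * B10.pFun b' (p₀ - 1) (Real.sqrt (γ * ((F.L : ℝ)⁻¹) ^ (K))) ^ 2))) := by
                  have h := hN 0 (Nat.zero_le j)
                  rw [Nat.sub_zero] at h
                  exact mul_le_mul_of_nonneg_right h (by positivity)
          · calc ∑ q ∈ (Finset.univ.filter fun q : Plaq (F.P K) i => Site.tdist (fun k => ((((q.src k).val * F.L ^ i : ℕ)) : ZMod ((F.P K).sitesPerDir 0))) (fun k => ((((a.src k).val * F.L ^ j : ℕ)) : ZMod ((F.P K).sitesPerDir 0))) + 64 * F.L ^ i ≤ 64 * F.L ^ j), (gibbsK F ℰp γ K).real ({U : GaugeField (F.P K) 0 (Matrix.specialUnitaryGroup (Fin 2) ℂ) | θBal F.L γ b₀ p₀ (K - i) ≤ GaugeGroup.dist1 (GaugeField.plaqHol (Averaging.iter (fun i' => BlockAveraging.blockAvg (P := F.P K) (j := i') ℰp) i U) q)}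 ∩ {U : GaugeField (F.P K) 0 (Matrix.specialUnitaryGroup (Fin 2) ℂ) | (∀ (i' : ℕ) (q' : Plaq (F.P K) i'), i' < i → Site.tdist (fun k => ((((q'.src k).val * F.L ^ i' : ℕ)) : ZMod ((F.P K).sitesPerDir 0))) (fun k => ((((q.src k).val * F.L ^ i : ℕ)) : ZMod ((F.P K).sitesPerDir 0))) + 64 * F.L ^ i' ≤ 64 * F.L ^ i → GaugeGroup.dist1 (GaugeField.plaqHol (Averaging.iter (fun i' => BlockAveraging.blockAvg (P := F.P K) (j := i') ℰp) i' U) q') < θBal F.L γ b₀ p₀ (K - i'))})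
                ≤ ∑ q ∈ (Finset.univ.filter fun q : Plaq (F.P K) i => Site.tdist (fun k => ((((q.src k).val * F.L ^ i : ℕ)) : ZMod ((F.P K).sitesPerDir 0))) (fun k => ((((a.src k).val * F.L ^ j : ℕ)) : ZMod ((F.P K).sitesPerDir 0))) + 64 * F.L ^ i ≤ 64 * F.L ^ j), Cc * Real.exp (-(c₁ * B10.pFun b' (p₀ - 1) (Real.sqrt (γ * ((F.L : ℝ)⁻¹) ^ (K - i))))) :=
                  Finset.sum_le_sum fun q _ => hi i hi' q
              _ = ((Finset.univ.filter fun q : Plaq (F.P K) i => Site.tdist (fun k => ((((q.src k).val * F.L ^ i : ℕ)) : ZMod ((F.P K).sitesPerDir 0))) (fun k => ((((a.src k).val * F.L ^ j : ℕ)) : ZMod ((F.P K).sitesPerDir 0))) + 64 * F.L ^ i ≤ 64 * F.L ^ j)).card * (Cc * Real.exp (-(c₁ * B10.pFun b' (p₀ - 1) (Real.sqrt (γ * ((F.L : ℝ)⁻¹) ^ (K - i)))))) := by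
                  rw [Finset.sum_const, nsmul_eq_mul]
              _ ≤ 9 * 129 ^ 3 * ((F.L : ℝ) ^ (j - i)) ^ 3 * (Cc * Real.exp (-(c₁ * B10.pFun b' (p₀ - 1) (Real.sqrt (γ * ((F.L : ℝ)⁻¹) ^ (K - i)))))) :=
                  mul_le_mul_of_nonneg_right (hN i (Finset.mem_Ico.mp hi').2.le) (by positivity)
      _ ≤ 1 / 4 := HA γ hγ hγA' K j (by omega)
  -- the box side `n = 17·L^j`: the guards of the m-relaxed concentration hypothesis and the three side facts of the K1 letter
  have hL3 : 3 ≤ F.L := by obtain ⟨k, hk⟩ := F.hL.1; have := F.hL.2; omega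
  have hLr : (3 : ℝ) ≤ F.L := by exact_mod_cast hL3
  have h1n : 1 ≤ 17 * F.L ^ j := by
    have : 1 ≤ F.L ^ j := Nat.one_le_pow _ _ (by omega)
    omega
  have hnK : 17 * F.L ^ j ≤ 17 * F.L ^ (K - 2) := Nat.mul_le_mul_left _ (Nat.pow_le_pow_right (by omega) (by omega))
  have hnm : 17 * F.L ^ j * F.L ^ ((K - 1) / m) ≤ 17 * F.L ^ K := by
    rw [mul_assoc, ← pow_add]
    exact Nat.mul_le_mul_left _ (Nat.pow_le_pow_right (by omega) (by omega))
  have h2n : 2 * (17 * F.L ^ j) ≤ (F.P K).sitesPerDir 0 := by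
    have hN0 : (F.P K).sitesPerDir 0 = 2 * F.L ^ (F.m + K) := by simp [Params.sitesPerDir]
    rw [hN0]
    have hsplit : F.L ^ (F.m + K) = F.L ^ j * F.L ^ (F.m + K - j) := by rw [← pow_add]; congr 1; omega
    have h27 : 27 ≤ F.L ^ (F.m + K - j) :=
      calc 27 = 3 ^ 3 := by norm_num
        _ ≤ F.L ^ 3 := Nat.pow_le_pow_left hL3 3
        _ ≤ F.L ^ (F.m + K - j) := Nat.pow_le_pow_right (by omega) (by have := F.hm; omega)
    rw [hsplit]
    nlinarith
  have hβK : (F.scheme ℰp γ).β K = (F.L : ℝ) ^ K / γ := by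
    show (γ * (F.P K).eps)⁻¹ = _
    have heps : (F.P K).eps = ((F.L : ℝ)⁻¹) ^ K := rfl
    rw [heps, mul_inv, inv_pow, inv_inv, div_eq_inv_mul]
  have hnβ : ((17 * F.L ^ j : ℕ) : ℝ) ≤ (F.scheme ℰp γ).β K := by
    rw [hβK, le_div_iff₀ hγ]
    push_cast
    have hsplit : (F.L : ℝ) ^ K = (F.L : ℝ) ^ j * (F.L : ℝ) ^ (K - j) := by rw [← pow_add]; congr 1; omega
    have h9 : (9 : ℝ) ≤ (F.L : ℝ) ^ (K - j) :=
      calc (9 : ℝ) = 3 ^ 2 := by norm_num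
        _ ≤ (F.L : ℝ) ^ 2 := pow_le_pow_left₀ (by norm_num) hLr 2
        _ ≤ (F.L : ℝ) ^ (K - j) := pow_le_pow_right₀ (by linarith) (by omega)
    rw [hsplit]
    have hLj : (0 : ℝ) < (F.L : ℝ) ^ j := by positivity
    nlinarith [mul_le_mul_of_nonneg_left hγ2 hLj.le, mul_le_mul_of_nonneg_left h9 hLj.le]
  exact local_step_lin_median_at F hγ hγ2 hb₀ hjK a hCL (HC F γ rfl hγ hγC' K (17 * F.L ^ j) h1n hnK hnm hnβ h2n)
    (HLip' F γ rfl hγ hγLip' K j hj hjK a) hcc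
    (hMM'.trans (le_pFun_of_coupling_small hL1 hγ hγ1 hb₀ (by linarith) hM'0 hγp' (K - j)))
    (HQ F γ rfl hγ hγQ' K j hj hjK hjm a) hGc

/-- ★★★ **`UnitScaleTilt.HistoryTailL ⟸ K1-exp-deepUV(m) ∧ BlockLipschitzL ∧ (Q)(m)`, for every `m`** (BY NAME): the crux of record from
the EXPONENTIAL concentration letter asked, for each free top fraction `1∕m`, only on box sides `n ≤ 17·L^(K−2)` with `n·L^⌊(K−1)∕m⌋ ≤ 17·L^K`
(constants after `m`), the deterministic K2 `BlockLipschitzL`, and the 3/4-quantile row asked only at heights `j + ⌊(K−1)∕m⌋ ≤ K` —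
✓`historyTailL_of_linearTail_deep` over `local_tail_lin_median_deep`.  Route glue: the three rows are NOT proved.
[cite: Balaban1985UV3, (7) p.257 and (71) p.273] -/
theorem historyTailL_of_deepUVBoxExpConcentration_quantile
    (hC : ∀ (L m : ℕ), 0 < m → ∃ (Cc cc : ℝ), 0 ≤ Cc ∧ 0 < cc ∧ ∃ γ₁ : ℝ, 0 < γ₁ ∧ γ₁ ≤ 1 ∧
      ∀ (F : T3Family) (γ : ℝ), F.L = L → 0 < γ → γ ≤ γ₁ → ∀ (K n : ℕ), 1 ≤ n → n ≤ 17 * F.L ^ (K - 2) →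
        n * F.L ^ ((K - 1) / m) ≤ 17 * F.L ^ K → (n : ℝ) ≤ (F.scheme ℰp γ).β K → 2 * n ≤ (F.P K).sitesPerDir 0 →
        ∀ (x₀ : Site (F.P K) 0) (f : GaugeField (F.P K) 0 (Matrix.specialUnitaryGroup (Fin 2) ℂ) → ℝ) (Λ : ℝ), 0 < Λ →
          Measurable f → GaugeField.GaugeInvariant f →
          (∀ U U' : GaugeField (F.P K) 0 (Matrix.specialUnitaryGroup (Fin 2) ℂ),
            (∀ b : PBond (F.P K) 0, (∀ k, (b.src k - x₀ k).val < n) → (∀ k, (b.tgt k - x₀ k).val < n) → U b = U' b) →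
              f U = f U') →
          (∀ U U' : GaugeField (F.P K) 0 (Matrix.specialUnitaryGroup (Fin 2) ℂ),
            |f U - f U'| ≤ Λ * Real.sqrt (∑ b : PBond (F.P K) 0, GaugeGroup.dist1 (U b * (U' b)⁻¹) ^ 2)) →
          ∀ r : ℝ, 0 ≤ r →
            (gibbsK F ℰp γ K).real {U | r ≤ f U - ∫ V, f V ∂(gibbsK F ℰp γ K)} ≤
              Cc * Real.exp (-(cc * Real.sqrt ((F.scheme ℰp γ).β K) * r / ((n : ℝ) * Λ))))
    (hLip : Summit.QuantumFields.YangMills.Theses.PoincareLipschitz.BlockLipschitzL)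
    (hQ : ∀ (L m : ℕ) (b₀ p₀ : ℝ), 0 < m → 0 < b₀ → 2 < p₀ → ∃ γ₁ : ℝ, 0 < γ₁ ∧ γ₁ ≤ 1 ∧ ∀ (F : T3Family) (γ : ℝ), F.L = L → 0 < γ → γ ≤ γ₁ →
            ∀ (K j : ℕ), 1 ≤ j → j + 2 ≤ K → j + (K - 1) / m ≤ K → ∀ a : Plaq (F.P K) j,
              3 / 4 ≤ (gibbsK F ℰp γ K).real {U : GaugeField (F.P K) 0 (Matrix.specialUnitaryGroup (Fin 2) ℂ) | GaugeGroup.dist1 (GaugeField.plaqHol (Averaging.iter (fun i' => BlockAveraging.blockAvg (P := F.P K) (j := i') ℰp) j U) a) ≤ θBal F.L γ b₀ p₀ (K - j) / 8}) :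
    Summit.QuantumFields.YangMills.Theses.UnitScaleTilt.HistoryTailL := by
  refine historyTailL_of_linearTail_deep fun L m hm => ?_
  obtain ⟨C, c, hC0, hc, H⟩ := local_tail_lin_median_deep hC hLip hQ L m hm
  refine ⟨C, c, hC0, hc, fun b₀ p₀ hb₀ hp₀ => ?_⟩
  obtain ⟨γ₁, hγ₁, hγ₁1, HF⟩ := H b₀ p₀ hb₀ hp₀
  refine ⟨γ₁, hγ₁, hγ₁1, fun F γ hFL hγ hle K j hj hjK hjm a => ?_⟩
  haveI := isProbabilityMeasure_gibbsK F ℰp hγ.le K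
  -- the global finer-small event lies in the local good set
  have hsub : ({U : GaugeField (F.P K) 0 (Matrix.specialUnitaryGroup (Fin 2) ℂ) | θBal F.L γ b₀ p₀ (K - j) ≤ GaugeGroup.dist1 (GaugeField.plaqHol (Averaging.iter (fun i' => BlockAveraging.blockAvg (P := F.P K) (j := i') ℰp) j U) a)} ∩
        {U : GaugeField (F.P K) 0 (Matrix.specialUnitaryGroup (Fin 2) ℂ) | ∀ i, i < j → PlaqSmall (θBal F.L γ b₀ p₀ (K - i)) (Averaging.iter (fun i' => BlockAveraging.blockAvg (P := F.P K) (j := i') ℰp) i U)}) ⊆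
      ({U : GaugeField (F.P K) 0 (Matrix.specialUnitaryGroup (Fin 2) ℂ) | θBal F.L γ b₀ p₀ (K - j) ≤ GaugeGroup.dist1 (GaugeField.plaqHol (Averaging.iter (fun i' => BlockAveraging.blockAvg (P := F.P K) (j := i') ℰp) j U) a)} ∩ {U : GaugeField (F.P K) 0 (Matrix.specialUnitaryGroup (Fin 2) ℂ) | (∀ (i : ℕ) (q : Plaq (F.P K) i), i < j → Site.tdist (fun k => ((((q.src k).val * F.L ^ i : ℕ)) : ZMod ((F.P K).sitesPerDir 0))) (fun k => ((((a.src k).val * F.L ^ j : ℕ)) : ZMod ((F.P K).sitesPerDir 0))) + 64 * F.L ^ i ≤ 64 * F.L ^ j → GaugeGroup.dist1 (GaugeField.plaqHol (Averaging.iter (fun i' => BlockAveraging.blockAvg (P := F.P K) (j := i') ℰp) i U) q) < θBal F.L γ b₀ p₀ (K - i))}) := by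
    rintro U ⟨hU1, hU2⟩
    exact ⟨hU1, fun i q hi _ => hU2 i hi q⟩
  exact (measureReal_mono hsub (measure_ne_top _ _)).trans (HF F γ hFL hγ hle K j hj hjK hjm a)

/-! ## §2 The face v15 -/

/-- ★★★ **K2-LANE FACE v15: THE CRUX BY NAME FROM K1-exp-deepUV(m) AND (Q)(m), FOR EVERY FREE TOP FRACTION `1∕m`** — the K2 row is the PROVED
crux `blockLipschitzL_proof`; per `m`, the K1 row is the exponential letter on box sides `n ≤ 17·L^(K−2)` with `n·L^⌊(K−1)∕m⌋ ≤ 17·L^K`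
(polynomially below `β_K`), the (Q) row the 3/4-quantile at heights `j + ⌊(K−1)∕m⌋ ≤ K`; constants may depend on `m`.
[cite: Balaban1985UV3, (71) p.273; Balaban1985Averaging, Prop. 1] -/
theorem historyTailL_of_K1deepUV_quantile
    (hK1m : ∀ (L m : ℕ), 0 < m → ∃ (Cc cc : ℝ), 0 ≤ Cc ∧ 0 < cc ∧ ∃ γ₁ : ℝ, 0 < γ₁ ∧ γ₁ ≤ 1 ∧
      ∀ (F : T3Family) (γ : ℝ), F.L = L → 0 < γ → γ ≤ γ₁ → ∀ (K n : ℕ), 1 ≤ n → n ≤ 17 * F.L ^ (K - 2) →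
        n * F.L ^ ((K - 1) / m) ≤ 17 * F.L ^ K → (n : ℝ) ≤ (F.scheme ℰp γ).β K → 2 * n ≤ (F.P K).sitesPerDir 0 →
        ∀ (x₀ : Site (F.P K) 0) (f : GaugeField (F.P K) 0 (Matrix.specialUnitaryGroup (Fin 2) ℂ) → ℝ) (Λ : ℝ), 0 < Λ →
          Measurable f → GaugeField.GaugeInvariant f →
          (∀ U U' : GaugeField (F.P K) 0 (Matrix.specialUnitaryGroup (Fin 2) ℂ),
            (∀ b : PBond (F.P K) 0, (∀ k, (b.src k - x₀ k).val < n) → (∀ k, (b.tgt k - x₀ k).val < n) → U b = U' b) →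
              f U = f U') →
          (∀ U U' : GaugeField (F.P K) 0 (Matrix.specialUnitaryGroup (Fin 2) ℂ),
            |f U - f U'| ≤ Λ * Real.sqrt (∑ b : PBond (F.P K) 0, GaugeGroup.dist1 (U b * (U' b)⁻¹) ^ 2)) →
          ∀ r : ℝ, 0 ≤ r →
            (gibbsK F ℰp γ K).real {U | r ≤ f U - ∫ V, f V ∂(gibbsK F ℰp γ K)} ≤
              Cc * Real.exp (-(cc * Real.sqrt ((F.scheme ℰp γ).β K) * r / ((n : ℝ) * Λ))))
    (hQm : ∀ (L m : ℕ) (b₀ p₀ : ℝ), 0 < m → 0 < b₀ → 2 < p₀ → ∃ γ₁ : ℝ, 0 < γ₁ ∧ γ₁ ≤ 1 ∧ ∀ (F : T3Family) (γ : ℝ), F.L = L → 0 < γ → γ ≤ γ₁ →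
            ∀ (K j : ℕ), 1 ≤ j → j + 2 ≤ K → j + (K - 1) / m ≤ K → ∀ a : Plaq (F.P K) j,
              3 / 4 ≤ (gibbsK F ℰp γ K).real {U : GaugeField (F.P K) 0 (Matrix.specialUnitaryGroup (Fin 2) ℂ) | GaugeGroup.dist1 (GaugeField.plaqHol (Averaging.iter (fun i' => BlockAveraging.blockAvg (P := F.P K) (j := i') ℰp) j U) a) ≤ θBal F.L γ b₀ p₀ (K - j) / 8})
    : Summit.QuantumFields.YangMills.Theses.UnitScaleTilt.HistoryTailL :=
  historyTailL_of_deepUVBoxExpConcentration_quantile hK1m blockLipschitzL_proof hQm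

end Summit.QuantumFields.YangMills.Theorems.PoincareLipschitzHistoryTailOfDeepUVBoxConcentration

end
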